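import Summits.Ventures.CertifiedManyBodySolver.Downfold.RouterWordScoreFePnictideTypings

/-!
# The Fe-pnictide TYPING FAMILIES of the v8 validation set in closed form (II): TRIPLE, what the typing choice decides,
# the receipts of 2026-08-29 and ruling R-vh (seat hubbard-downfold-score-2 gen 19; kernel facts of the ACCEPTANCE §4.2 score)

Venture CertifiedManyBodySolver, cell `pub/hubbard-downfold`; namespace `Summit.Ventures.CertifiedManyBodySolver.Downfold.RouterScore`.
Sequel of `RouterWordScoreFePnictideTypings.lean` (FEPAIR / ORDPAIR / UNION). Everything here is PROVED (no `sorry`, standard axioms).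

* §1 TRIPLE «EPH | UND:MIXED+EPH | UND:MULTIORB+EPH» IN CLOSED FORM (`score_triple`, `triple_agree_iff`): every «EPH»-led print and
  every d-head WITH «EPH» riding is `AGREE`, the rider-less d-head is `PARTIAL` (`triple_riderless_dhead`), a print with none of
  the three typed primaries is `DISAGREE`;
* §2 the comparison the lead's letters (d) turn on — `khead_print_typing_immune` (a k-head print with «EPH» riding is `AGREE`
  under all four typings: «the typing choice only decides what a straddle-only or a bare-EPH print would cost»), `khead_riderless`,
  `bare_eph_cost` (bare «EPH»: TRIPLE `AGREE`, FEPAIR / ORDPAIR / UNION `DISAGREE`), `straddle_only_cost` («UND:MIXED(…)+EPH»: TRIPLE /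
  UNION `AGREE`, FEPAIR / ORDPAIR `DISAGREE`), `mixed_led_composite_cost`, `fepair_agree_imp_union_agree`,
  `union_agree_imp_triple_agree_of_eph_riding`, `hf_led_cost`;
* §3 the receipts of 2026-08-29 as instances (boxes #364 M460, #367 M458, #368 M457: «UND:MULTIORB(k=5; J_H)+EPH» ⇒ AGREE under
  FEPAIR; #359 M453 straddle+EPH under TRIPLE; #360 M454 k-head under UNION) and the 42622 PAIR IMMUNITY (V8-272 non-SC / V8-273 SC
  typed identically ⇒ one print scores one cell on both rows: the SC-vs-non-SC content of the pair is read by the §4.4–§4.6 cell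
  clauses, never by §4.2) with the pre-named arms that did not print;
* §4 RULING R-vh (box #365 M311 PrOs₄Sb₁₂, typed «UND:HF»): the v1 token «UND:HF-candidate(…)+UND:HF(…)» ⇒ `PARTIAL`, the v1.1
  construction word «UND:HF-candidate(…)+EPH» ⇒ `DISAGREE` (pre-named shape (b) of 'pros4sb12'), and the general step behind it
  (`single_typed_rider_step`: on a row typed by one single-token word, dropping that rider from a print led by another head is
  exactly PARTIAL → DISAGREE).

WHAT THIS IS NOT: not physics; not the scorer of record; not a typing ruling; heads carry no payload (see part I).
-/

namespace Summit.Ventures.CertifiedManyBodySolver.Downfold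

namespace RouterScore

open Head

/-! ## §1 TRIPLE in closed form -/


/-- TRIPLE IN CLOSED FORM: structural head ⇒ abstain; led by «EPH», or led by a d-head WITH «EPH» riding ⇒ `AGREE`;
otherwise `PARTIAL` iff one of the three typed primaries occurs in the print (the rider-less d-head; an untyped head with
«EPH» or a d-head behind it), else `DISAGREE`. [folklore] -/
theorem score_triple (p : Head) (tl : List Head) :
    score (p :: tl) triple =
      (if p.structural then .ABSTAIN_structure
       else if p = eph ∨ ((p = undMixed ∨ p = undMultiorb) ∧ eph ∈ tl) then .AGREE
       else if eph ∈ tl ∨ undMixed ∈ p :: tl ∨ undMultiorb ∈ p :: tl then .PARTIAL else .DISAGREE) := by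
  by_cases hs : p.structural = true
  · rw [if_pos hs]; exact (score_structural_led p tl hs).2.1
  rw [if_neg hs]
  have hs' : p.structural = false := by simpa using hs
  have hgate : (p.structural && !expectsStructural Head.structural triple) = false := by rw [hs']; rfl
  by_cases hp : p = eph ∨ ((p = undMixed ∨ p = undMultiorb) ∧ eph ∈ tl)
  · rw [if_pos hp]
    rcases hp with rfl | ⟨rfl | rfl, he⟩
    · rw [show score (eph :: tl) triple = outcome Head.structural (eph :: tl) triple from rfl]
      rw [outcome_alts_congr Head.structural (eph :: tl)
        (alts' := [[undMixed, eph], [undMultiorb, eph]] ++ [eph :: []])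
        (by intro a; simp only [triple, List.mem_append, List.mem_cons, List.not_mem_nil, or_false]; tauto)]
      exact outcome_eq_agree_of_self_typed Head.structural _ rfl (fun t ht => absurd ht (by simp))
    · rw [show score (undMixed :: tl) triple = outcome Head.structural (undMixed :: tl) triple from rfl]
      rw [outcome_alts_congr Head.structural (undMixed :: tl)
        (alts' := [[eph], [undMultiorb, eph]] ++ [undMixed :: [eph]])
        (by intro a; simp only [triple, List.mem_append, List.mem_cons, List.not_mem_nil, or_false]; tauto)]
      exact outcome_eq_agree_of_self_typed Head.structural _ rfl
        (fun t ht => by simp only [List.mem_singleton] at ht; subst ht; exact List.mem_cons_of_mem _ he)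
    · have : triple = [[eph], [undMixed, eph]] ++ [undMultiorb :: [eph]] := rfl
      rw [show score (undMultiorb :: tl) triple = outcome Head.structural (undMultiorb :: tl) triple from rfl, this]
      exact outcome_eq_agree_of_self_typed Head.structural _ rfl
        (fun t ht => by simp only [List.mem_singleton] at ht; subst ht; exact List.mem_cons_of_mem _ he)
  rw [if_neg hp]
  rw [not_or, not_and_or] at hp
  have hne0 : eph ≠ p := fun h => hp.1 h.symm
  -- no alternative fully matches
  have hnot : eph ∉ p :: tl → ∀ q secs, fullMatch (p :: tl) (q :: eph :: secs) = false := fun hm q secs =>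
    fullMatch_eq_false_of_not_mem (List.mem_cons_of_mem _ List.mem_cons_self) hm
  have hnofull : ∀ a ∈ triple, fullMatch (p :: tl) a = false := by
    intro a ha
    simp only [triple, List.mem_cons, List.not_mem_nil, or_false] at ha
    rcases ha with rfl | rfl | rfl
    · exact fullMatch_eq_false_of_head_ne hne0
    · rcases hp.2 with hh | he
      · exact fullMatch_eq_false_of_head_ne (fun h => hh (Or.inl h.symm))
      · exact hnot (fun hm => by rcases List.mem_cons.1 hm with h | h; exacts [hne0 h, he h]) _ _
    · rcases hp.2 with hh | he
      · exact fullMatch_eq_false_of_head_ne (fun h => hh (Or.inr h.symm))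
      · exact hnot (fun hm => by rcases List.mem_cons.1 hm with h | h; exacts [hne0 h, he h]) _ _
  by_cases hm : eph ∈ tl ∨ undMixed ∈ p :: tl ∨ undMultiorb ∈ p :: tl
  · rw [if_pos hm]
    refine outcome_eq_partial_of Head.structural (by decide) hgate hnofull ?_
    rcases hm with hm | hm | hm
    · exact ⟨[eph], by simp [triple], by rw [primaryEmitted_cons_eq]; simp [hm]⟩
    · exact ⟨[undMixed, eph], by simp [triple], by rw [primaryEmitted_cons_eq]; simpa using hm⟩
    · exact ⟨[undMultiorb, eph], by simp [triple], by rw [primaryEmitted_cons_eq]; simpa using hm⟩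
  · rw [if_neg hm]
    rw [not_or, not_or] at hm
    refine outcome_eq_disagree_of_no_primary_emitted Head.structural (by decide) hgate ?_
    intro a ha
    simp only [triple, List.mem_cons, List.not_mem_nil, or_false] at ha
    rcases ha with rfl | rfl | rfl
    · rw [primaryEmitted_cons_eq]; simp [hm.1, hne0]
    · rw [primaryEmitted_cons_eq]; simpa using hm.2.1
    · rw [primaryEmitted_cons_eq]; simpa using hm.2.2

/-- TRIPLE: `AGREE` iff led by «EPH», or led by a d-head with «EPH» riding («every EPH-riding print AGREE»). [folklore] -/
theorem triple_agree_iff (p : Head) (tl : List Head) :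
    score (p :: tl) triple = .AGREE ↔ p = eph ∨ ((p = undMixed ∨ p = undMultiorb) ∧ eph ∈ tl) := by
  rw [score_triple]
  by_cases hs : p.structural = true
  · rw [if_pos hs]; constructor
    · intro h; exact absurd h (by decide)
    · rintro (rfl | ⟨rfl | rfl, _⟩) <;> exact absurd hs (by decide)
  rw [if_neg hs]
  by_cases hp : p = eph ∨ ((p = undMixed ∨ p = undMultiorb) ∧ eph ∈ tl)
  · rw [if_pos hp]; exact ⟨fun _ => hp, fun _ => rfl⟩
  rw [if_neg hp]
  by_cases hm : eph ∈ tl ∨ undMixed ∈ p :: tl ∨ undMultiorb ∈ p :: tl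
  · rw [if_pos hm]; exact ⟨fun h => absurd h (by decide), fun h => absurd h hp⟩
  · rw [if_neg hm]; exact ⟨fun h => absurd h (by decide), fun h => absurd h hp⟩

/-- TRIPLE: the rider-less d-head print («UND:MULTIORB» / «UND:MIXED» with no «EPH» behind) is `PARTIAL`. [folklore] -/
theorem triple_riderless_dhead (p : Head) (tl : List Head) (hp : p = undMultiorb ∨ p = undMixed) (he : eph ∉ tl) :
    score (p :: tl) triple = .PARTIAL := by
  rw [score_triple]
  rcases hp with rfl | rfl
  · rw [if_neg (by decide), if_neg (by rintro (h | ⟨_, h⟩); exact absurd h (by decide); exact he h),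
      if_pos (Or.inr (Or.inr List.mem_cons_self))]
  · rw [if_neg (by decide), if_neg (by rintro (h | ⟨_, h⟩); exact absurd h (by decide); exact he h),
      if_pos (Or.inr (Or.inl List.mem_cons_self))]

/-! ## §2 What the typing choice decides (the lead's letters (d): FEPAIR vs TRIPLE vs UNION) -/

/-- THE k-HEAD PRINT IS TYPING-IMMUNE: «UND:MULTIORB(…)» leading with «EPH» riding (the 1111-parent print of record,
NM or STRIPE leg) is `AGREE` under FEPAIR, ORDPAIR, TRIPLE and UNION alike, whatever else rides. [folklore] -/
theorem khead_print_typing_immune (tl : List Head) (he : eph ∈ tl) :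
    score (undMultiorb :: tl) fepair = .AGREE ∧ score (undMultiorb :: tl) ordpair = .AGREE ∧
    score (undMultiorb :: tl) triple = .AGREE ∧ score (undMultiorb :: tl) union = .AGREE := by
  refine ⟨(fepair_agree_iff _ _).2 rfl, ?_, (triple_agree_iff _ _).2 (Or.inr ⟨Or.inr rfl, he⟩),
    (union_agree_iff _ _).2 (Or.inl rfl)⟩
  rw [score_ordpair_eq_fepair]; exact (fepair_agree_iff _ _).2 rfl

/-- … and without the «EPH» rider it is still `AGREE` under FEPAIR / ORDPAIR / UNION, `PARTIAL` under TRIPLE. [folklore] -/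
theorem khead_riderless (tl : List Head) (he : eph ∉ tl) :
    score (undMultiorb :: tl) fepair = .AGREE ∧ score (undMultiorb :: tl) ordpair = .AGREE ∧
    score (undMultiorb :: tl) union = .AGREE ∧ score (undMultiorb :: tl) triple = .PARTIAL := by
  refine ⟨(fepair_agree_iff _ _).2 rfl, ?_, (union_agree_iff _ _).2 (Or.inl rfl),
    triple_riderless_dhead _ _ (Or.inl rfl) he⟩
  rw [score_ordpair_eq_fepair]; exact (fepair_agree_iff _ _).2 rfl

/-- THE COST OF A BARE «EPH» (no d-head anywhere: the phosphide-class print with the Fe moment collapsed AND no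
k-head): `AGREE` under TRIPLE, `DISAGREE` under FEPAIR, ORDPAIR and UNION. [folklore] -/
theorem bare_eph_cost (tl : List Head) (h1 : undMultiorb ∉ tl) (h2 : undMixed ∉ tl) :
    score (eph :: tl) triple = .AGREE ∧ score (eph :: tl) fepair = .DISAGREE ∧
    score (eph :: tl) ordpair = .DISAGREE ∧ score (eph :: tl) union = .DISAGREE := by
  have hf : score (eph :: tl) fepair = .DISAGREE :=
    (fepair_disagree_iff _ _).2 ⟨rfl, by simp [h1]⟩
  refine ⟨(triple_agree_iff _ _).2 (Or.inl rfl), hf, by rw [score_ordpair_eq_fepair]; exact hf,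
    (union_disagree_iff _ _).2 ⟨rfl, by simp [h1], by simp [h2]⟩⟩

/-- THE COST OF THE STRADDLE-ONLY PRINT «UND:MIXED(r_man …)+EPH» (no «UND:MULTIORB» clause): `AGREE` under TRIPLE and
UNION, `DISAGREE` under FEPAIR / ORDPAIR («MIXED untyped here»). [folklore] -/
theorem straddle_only_cost (tl : List Head) (he : eph ∈ tl) (h1 : undMultiorb ∉ tl) :
    score (undMixed :: tl) triple = .AGREE ∧ score (undMixed :: tl) union = .AGREE ∧
    score (undMixed :: tl) fepair = .DISAGREE ∧ score (undMixed :: tl) ordpair = .DISAGREE := by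
  have hf : score (undMixed :: tl) fepair = .DISAGREE :=
    (fepair_disagree_iff _ _).2 ⟨rfl, by simp [h1]⟩
  exact ⟨(triple_agree_iff _ _).2 (Or.inr ⟨Or.inl rfl, he⟩), (union_agree_iff _ _).2 (Or.inr rfl), hf,
    by rw [score_ordpair_eq_fepair]; exact hf⟩

/-- THE MIXED-LED D10 COMPOSITE «UND:MIXED(m …)+UND:MULTIORB(…)+EPH» (a kept stripe moment between the arms): `PARTIAL`
under FEPAIR / ORDPAIR, `AGREE` under TRIPLE and UNION. [folklore] -/
theorem mixed_led_composite_cost (tl : List Head) (hk : undMultiorb ∈ tl) (he : eph ∈ tl) :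
    score (undMixed :: tl) fepair = .PARTIAL ∧ score (undMixed :: tl) ordpair = .PARTIAL ∧
    score (undMixed :: tl) triple = .AGREE ∧ score (undMixed :: tl) union = .AGREE := by
  have hf : score (undMixed :: tl) fepair = .PARTIAL := (fepair_partial_iff _ _).2 ⟨rfl, by decide, hk⟩
  exact ⟨hf, by rw [score_ordpair_eq_fepair]; exact hf, (triple_agree_iff _ _).2 (Or.inr ⟨Or.inl rfl, he⟩),
    (union_agree_iff _ _).2 (Or.inr rfl)⟩

/-- FEPAIR is the STRICTEST of the d-typings: FEPAIR-`AGREE` ⇒ UNION-`AGREE`. [folklore] -/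
theorem fepair_agree_imp_union_agree (p : Head) (tl : List Head) (h : score (p :: tl) fepair = .AGREE) :
    score (p :: tl) union = .AGREE :=
  (union_agree_iff _ _).2 (Or.inl ((fepair_agree_iff _ _).1 h))

/-- UNION-`AGREE` with «EPH» riding ⇒ TRIPLE-`AGREE`. [folklore] -/
theorem union_agree_imp_triple_agree_of_eph_riding (p : Head) (tl : List Head) (he : eph ∈ tl)
    (h : score (p :: tl) union = .AGREE) : score (p :: tl) triple = .AGREE := by
  rcases (union_agree_iff _ _).1 h with rfl | rfl
  · exact (triple_agree_iff _ _).2 (Or.inr ⟨Or.inr rfl, he⟩)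
  · exact (triple_agree_iff _ _).2 (Or.inr ⟨Or.inl rfl, he⟩)

/-- A comparator / Kondo head LEADING is never `AGREE` under any of the four typings (riders behind the Fe head never
hurt; the same token leading costs the cell) — e.g. «UND:HF(w_f)(…)» alone is `DISAGREE` ×4, with «UND:MULTIORB+EPH»
behind it `PARTIAL` under FEPAIR / ORDPAIR / UNION / TRIPLE. [folklore] -/
theorem hf_led_cost :
    (score [undHF] fepair = .DISAGREE ∧ score [undHF] ordpair = .DISAGREE ∧ score [undHF] triple = .DISAGREE ∧
      score [undHF] union = .DISAGREE) ∧
    (score [undHF, undMultiorb, eph] fepair = .PARTIAL ∧ score [undHF, undMultiorb, eph] ordpair = .PARTIAL ∧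
      score [undHF, undMultiorb, eph] triple = .PARTIAL ∧ score [undHF, undMultiorb, eph] union = .PARTIAL) ∧
    score [undMultiorb, eph, undHF] fepair = .AGREE ∧ score [undMultiorb, eph, other 1] fepair = .AGREE := by decide

/-! ## §3 The receipts of 2026-08-29 and the 42622 pair immunity -/

/-- Boxes #364 M460 EuFe₂P₂, #367 M458 Ca₄Al₂O₆Fe₂As₂, #368 M457 Sr₄Sc₂O₆Fe₂As₂ (FEPAIR; print «UND:MULTIORB(k=5; J_H)+EPH»)
⇒ AGREE; #359 M453 CaFe₂P₂ (TRIPLE; straddle print «UND:MIXED(r_man …)+EPH») ⇒ AGREE; #360 M454 SrFe₂P₂ (UNION; k-head print)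
⇒ AGREE; M455 (ORDPAIR; k-head print) ⇒ AGREE — every receipt «as registered». [folklore] -/
theorem receipts_0829 :
    score [undMultiorb, eph] fepair = .AGREE ∧ score [undMixed, eph] triple = .AGREE ∧
    score [undMultiorb, eph] union = .AGREE ∧ score [undMultiorb, eph] ordpair = .AGREE := by decide

/-- THE 42622 PAIR IS WORD-IMMUNE BY CONSTRUCTION: V8-272 Sr₄Sc₂O₆Fe₂As₂ (known-nonSC) and V8-273 Ca₄Al₂O₆Fe₂As₂ (SC 27 K)
carry the SAME typing, so any one print scores the same §4.2 cell on both rows — the SC-vs-non-SC content of the pair is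
invisible to the router-word score (it is read by the §4.4–§4.6 cell clauses). [folklore] -/
theorem pair_42622_word_immune (M457typing M458typing : List (List Head)) (h457 : M457typing = fepair)
    (h458 : M458typing = fepair) (e : List Head) : score e M457typing = score e M458typing := by
  rw [h457, h458]

/-- The pre-named non-AGREE arms of the 42622 registrations did not print; had they, the cells would have read: MIXED-led
D10 composite ⇒ PARTIAL, straddle-only ⇒ DISAGREE, bare «EPH» ⇒ DISAGREE, «UND:STRUCT(…)»-led ⇒ ABSTAIN(structure).
[folklore] -/
theorem prenamed_arms_42622 :
    score [undMixed, undMultiorb, eph] fepair = .PARTIAL ∧ score [undMixed, eph] fepair = .DISAGREE ∧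
    score [eph] fepair = .DISAGREE ∧ score [eph, undStruct] fepair = .DISAGREE ∧
    score [undStruct, undMultiorb, eph] fepair = .ABSTAIN_structure := by decide

/-! ## §4 RULING R-vh: the word of record is the pre-registered construction's word (box #365 M311 PrOs₄Sb₁₂) -/

/-- M311 PrOs₄Sb₁₂ is typed «UND:HF» (the heavy-fermion letter). The v1 LANDED token «UND:HF-candidate(RE-4f test …)+UND:HF(w_f
…)» (`other 1` leading, `undHF` riding) ⇒ `PARTIAL`; the v1.1 CONSTRUCTION word «UND:HF-candidate(…)+EPH» (the «UND:HF» token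
came only from a prose string in a field the router reserves for 4f-removed treatments; R-vh reverts to the registration)
⇒ `DISAGREE` = pre-named shape (b) of 'pros4sb12'; the plain Kondo-lattice print «UND:HF(w_f …)» would have been `AGREE`;
the f-less twin #336 LaOs₄Sb₁₂ «EPH» on «EPH» ⇒ `AGREE`. The receipt therefore MOVES (PARTIAL → DISAGREE-informative) although
no number moved — by the pen's own pre-named rule. [folklore] -/
theorem rvh_pros4sb12 :
    score [other 1, undHF] [[undHF]] = .PARTIAL ∧ score [other 1, eph] [[undHF]] = .DISAGREE ∧
    score [undHF] [[undHF]] = .AGREE ∧ score [eph] [[eph]] = .AGREE := by decide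

/-- The general shape behind R-vh's receipt move: on a row typed by ONE single-token word `[q]`, a print led by an untyped
head `p ≠ q` is `PARTIAL` iff `q` rides and `DISAGREE` iff it does not — removing the rider is exactly the step PARTIAL →
DISAGREE (G15 §1 ceiling and floor). [folklore] -/
theorem single_typed_rider_step (p q : Head) (tl : List Head) (hp : p.structural = false) (hne : p ≠ q) :
    (q ∈ tl → score (p :: tl) [[q]] = .PARTIAL) ∧ (q ∉ tl → score (p :: tl) [[q]] = .DISAGREE) := by
  have hgate : (p.structural && !expectsStructural Head.structural [[q]]) = false := by rw [hp]; rfl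
  have hne' : q ≠ p := fun h => hne h.symm
  constructor
  · intro hq
    refine outcome_eq_partial_of Head.structural (by simp) hgate ?_ ⟨[q], by simp, by rw [primaryEmitted_cons_eq]; simp [hq]⟩
    intro a ha
    simp only [List.mem_singleton] at ha
    subst ha
    exact fullMatch_eq_false_of_head_ne hne'
  · intro hq
    refine outcome_eq_disagree_of_no_primary_emitted Head.structural (by simp) hgate ?_
    intro a ha
    simp only [List.mem_singleton] at ha
    subst ha
    rw [primaryEmitted_cons_eq]; simp [hq, hne']

/-! ## §5 Two-site prints: the FIRST printed site governs (desk convention, lead g28 STATUS l.9053 (ii), 2026-08-29)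

A two-d-species router line «W₁@site₁; W₂@site₂» (ROUTER §3 R6 form) is scored on the token list of the FIRST group followed
by the site-tagged tokens of the later groups (`router_score._split_words`); site tags do not change heads, so in head terms
the print is the concatenation `g₁ ++ g₂` and its primary is the head of `g₁`. Receipt #369 M247 Sr₂VO₃FeAs printed «…@V; …@Fe»
with a k-head in BOTH groups (AGREE in either order); the desk then ruled «print the truth's PRIMARY site first» going forward. -/

/-- Under FEPAIR (and ORDPAIR) a two-site print is `AGREE` iff its FIRST group is led by «UND:MULTIORB» — whatever the second
group prints. [folklore] -/
theorem two_site_fepair_agree_iff (p : Head) (g₁ g₂ : List Head) :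
    score ((p :: g₁) ++ g₂) fepair = .AGREE ↔ p = undMultiorb := by
  rw [List.cons_append]; exact fepair_agree_iff p (g₁ ++ g₂)

/-- Both groups k-led ⇒ `AGREE` in either site order (the #369 shape: the order was immaterial THAT day). [folklore] -/
theorem two_site_both_kheads (g₁ g₂ : List Head) :
    score ((undMultiorb :: g₁) ++ (undMultiorb :: g₂)) fepair = .AGREE ∧
    score ((undMultiorb :: g₂) ++ (undMultiorb :: g₁)) fepair = .AGREE :=
  ⟨(two_site_fepair_agree_iff _ _ _).2 rfl, (two_site_fepair_agree_iff _ _ _).2 rfl⟩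

/-- SITE ORDER MATTERS as soon as exactly one group is k-led: a k-led group FIRST with a straddle-led group behind is `AGREE`;
the same two groups in the other order read `PARTIAL` (the «UND:MULTIORB» token then only rides). Hence the convention:
print the truth's primary site first, so the cell reads the site the typing is about. [folklore] -/
theorem two_site_order_matters (g₁ g₂ : List Head) :
    score ((undMultiorb :: g₁) ++ (undMixed :: g₂)) fepair = .AGREE ∧
    score ((undMixed :: g₂) ++ (undMultiorb :: g₁)) fepair = .PARTIAL := by
  refine ⟨(two_site_fepair_agree_iff _ _ _).2 rfl, ?_⟩
  rw [List.cons_append]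
  exact (fepair_partial_iff _ _).2 ⟨rfl, by decide, List.mem_append_right _ List.mem_cons_self⟩

/-- … and the same holds under ORDPAIR (M468 / M469 / M471 / M472 «@Cr sheet; @Cr net»). [folklore] -/
theorem two_site_order_matters_ordpair (g₁ g₂ : List Head) :
    score ((undMultiorb :: g₁) ++ (undMixed :: g₂)) ordpair = .AGREE ∧
    score ((undMixed :: g₂) ++ (undMultiorb :: g₁)) ordpair = .PARTIAL := by
  rw [score_ordpair_eq_fepair, score_ordpair_eq_fepair]; exact two_site_order_matters g₁ g₂

/-- Under TRIPLE / COTRIPLE (M467 «@Co; @Cr») an «EPH»-led first group is `AGREE` whatever the block group prints behind it.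
[folklore] -/
theorem two_site_triple_eph_first (g₁ g₂ : List Head) : score ((eph :: g₁) ++ g₂) triple = .AGREE := by
  rw [List.cons_append]; exact (triple_agree_iff _ _).2 (Or.inl rfl)

end RouterScore

end Summit.Ventures.CertifiedManyBodySolver.Downfold
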